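import Mathlib
import Summits.ValiantsHypothesis.ValiantsHypothesis.Theorems.DivisionGapPerMultiplesHardStubTypedDecompositionLocal
import Summits.ValiantsHypothesis.ValiantsHypothesis.Theorems.DivisionGapPerMultiplesHardSpreadPatternsRel
import Literature.Computability.AlgebraicComplexity.ArithCircuitProofs
import Literature.Computability.AlgebraicComplexity.PermanentIrreducible

/-!
# The local relative spread engine for hybrid probes (line `uncharged-face-walk` of crux
`PerMultiplesHard`, route DivisionGap; stub `stub_hybridSpreadRel`)

Fix a block `A × B` of the `n × n` board, a row shift `ζ : Equiv.Perm (Fin n)` preserving `A`, and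
a dump column `bd`.  For a permutation `π` mapping `B` onto `A`, a HYBRID PROBE for `π` is an
exponent table `M ∈ supp g` whose cells in the rows of `A` are `(i, π⁻¹ i)` or `(i, π⁻¹ (ζ i))`
(`∀ (a, b) ∈ supp M, a ∈ A → π b = a ∨ π b = ζ a`) and whose cells in the columns of `B ∖ {bd}` lie
in rows of `A`.  The LOCAL relative spread engine (`stub_hybridSpreadRel`): for a window
`3 ≤ D ≤ #A`, a torus-homogeneous `g ∈ ℝ≥0[x_ij]` (all monomials share the row margins `R` and the
column margins `C`) with the rows of `A` hit, and ANY comparison set `P` of permutations, some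
typed rectangle `(S, T)` with `#A < D · #(S ∩ A) ≤ 2 · #A` has
`#{π ∈ P : supp g has a hybrid probe for π} ≤ L(g) · #{π ∈ P : π block-compatible with (S, T)}`
(`L = complexity` over `ℝ≥0`), where block-compatibility is the pair of conditions
(H) `∀ i ∈ S ∩ A, π⁻¹ i ∈ T ∨ π⁻¹ (ζ i) ∈ T` and
(C) `∀ j ∈ T ∩ B, j ≠ bd → π j ∈ S ∨ ζ⁻¹ (π j) ∈ S`.

Proof: the LOCAL typed decomposition `g = Σ_{t<s} a_t b_t`, `s ≤ L(g)`, every `a_t` typed with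
margins `(ρ_t, γ_t)` and local row support `#A < D · #{i ∈ A | ρ_t i ≠ 0} ≤ 2 · #A`
(`TypedDecompositionLocal.stub_typedDecompositionLocal`); RIGIDITY (`rigid_of_hybridProbe`): a
hybrid probe `M ∈ supp (a_t b_t)` for `π` makes `π` block-compatible with
`(S_t, T_t) = ({ρ_t ≠ 0}, {γ_t ≠ 0})` (write `M = X + Y` with `X ∈ supp a_t`, `X ≤ M`; a row
`i ∈ A` with `ρ_t i ≠ 0` has a cell `(i, j₀)` of `X`, a probe cell, and `γ_t j₀ ≠ 0`; a column
`j ∈ B ∖ {bd}` with `γ_t j ≠ 0` has a cell `(r, j)` of `X` with `r ∈ A`, so `π j = r ∨ π j = ζ r`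
and `ρ_t r ≠ 0`); hence the probed part of `P` lies in the union over `t` of the block-compatible
parts of `P` (`supp Σ ⊆ ⋃ supp`), of total size `≤ s · max_t` (`card_le_mul_max`,
`Finset.exists_max_image`), and `S_t ∩ A = {i ∈ A | ρ_t i ≠ 0}` carries the window.  If `s = 0`
then `g = 0`, nothing is probed, and any `S ⊆ A` with `#S = ⌊#A / D⌋ + 1` (`exists_local_window`)
with `T = ∅` will do.

-- adapted from Theorems/DivisionGapPerMultiplesHardSpreadPatternsRel.lean (p125091:
`relCount_le_mul_max`, `stub_spreadPatternsRel`) and Theorems/DivisionGapPerMultiplesHardSpreadPatterns.lean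
(`spreadCompatible_of_probe`), with the full board replaced by the block `A × B`.
-/

noncomputable section

-- the namespace `Summit.ValiantsHypothesis.ValiantsHypothesis.…` is mandated by the crux (registered stub names)
set_option linter.dupNamespace false

namespace Summit.ValiantsHypothesis.ValiantsHypothesis.Theorems.DivisionGap.PerMultiplesHard.HybridSpreadRel

open MvPolynomial Finset Literature.Computability.AlgebraicComplexity
open scoped NNReal BigOperators

/-- **A local window set exists.**  For `3 ≤ D ≤ #A` there is `S ⊆ A` with `#A < D · #S ≤ 2 · #A`:
any `⌊#A / D⌋ + 1` rows of `A` (`D (⌊#A/D⌋ + 1) > #A` and `D (⌊#A/D⌋ + 1) ≤ #A + D ≤ 2 #A`).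
[folklore] -/
theorem exists_local_window (D : ℕ) {n : ℕ} (A : Finset (Fin n)) (hD : 3 ≤ D) (hDA : D ≤ A.card) :
    ∃ S ⊆ A, A.card < D * S.card ∧ D * S.card ≤ 2 * A.card := by
  have hlt : A.card / D < A.card := Nat.div_lt_self (by omega) (by omega)
  have hle : A.card / D + 1 ≤ A.card := hlt
  obtain ⟨S, hSA, hS⟩ := Finset.exists_subset_card_eq hle
  have h1 : D * (A.card / D) + A.card % D = A.card := Nat.div_add_mod A.card D
  have h2 : A.card % D < D := Nat.mod_lt A.card (by omega)
  refine ⟨S, hSA, ?_, ?_⟩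
  · rw [hS, mul_add, mul_one]; omega
  · rw [hS, mul_add, mul_one]; omega

/-- **Union bound with a maximising index.**  For `s > 0` and sets `F t` (`t < s`) there is an
index `t₀` (one maximising `#(F t)`) such that every `X ⊆ ⋃_{t < s} F t` has `#X ≤ s · #(F t₀)`
(`Finset.card_biUnion_le`, `Finset.exists_max_image`). [folklore] -/
theorem card_le_mul_max {α : Type*} [DecidableEq α] {s : ℕ} (hs : 0 < s) (F : Fin s → Finset α) :
    ∃ t₀ : Fin s, ∀ X : Finset α, X ⊆ Finset.univ.biUnion F → X.card ≤ s * (F t₀).card := by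
  obtain ⟨t₀, -, ht₀⟩ := Finset.exists_max_image (Finset.univ : Finset (Fin s))
    (fun t => (F t).card) ⟨⟨0, hs⟩, Finset.mem_univ _⟩
  refine ⟨t₀, fun X h => ?_⟩
  calc X.card ≤ (Finset.univ.biUnion F).card := Finset.card_le_card h
    _ ≤ ∑ t, (F t).card := Finset.card_biUnion_le
    _ ≤ ∑ _t : Fin s, (F t₀).card := Finset.sum_le_sum fun t _ => ht₀ t (Finset.mem_univ t)
    _ = s * (F t₀).card := by
      rw [Finset.sum_const, Finset.card_univ, Fintype.card_fin, smul_eq_mul]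

/-- **Rigidity of hybrid probes** (the content of the registered stub `stub_hybridRigidity`, in the
form used here).  Let `a` be torus-homogeneous with margins `(ρ, γ)` and let `M ∈ supp (a · b)` be a
hybrid probe for `π`: every cell of `M` in a row of `A` is `(i, π⁻¹ i)` or `(i, π⁻¹ (ζ i))`, and
every cell of `M` in a column of `B` other than `bd` lies in a row of `A`.  Put
`S = {i | ρ i ≠ 0}`, `T = {j | γ j ≠ 0}`.  Then (H) every `i ∈ S ∩ A` has
`π⁻¹ i ∈ T ∨ π⁻¹ (ζ i) ∈ T`, and (C) every `j ∈ T ∩ B`, `j ≠ bd`, has `π j ∈ S ∨ ζ⁻¹ (π j) ∈ S`.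
Proof: `M = X + Y` with `X ∈ supp a` (`MvPolynomial.support_mul`), so `X ≤ M` cellwise; a row
`i ∈ S ∩ A` has a cell `(i, j₀)` of `X`, which is a cell of `M` in a row of `A`, hence a probe
cell, and `γ j₀ ≥ X (i, j₀) > 0`; a column `j ∈ T ∩ B`, `j ≠ bd`, has a cell `(r, j)` of `X`,
a cell of `M`, so `r ∈ A`, hence `π j = r ∨ π j = ζ r`, and `ρ r ≥ X (r, j) > 0`. [folklore] -/
theorem rigid_of_hybridProbe {n : ℕ} {A B : Finset (Fin n)} {ζ : Equiv.Perm (Fin n)} {bd : Fin n}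
    {a b : MvPolynomial (Fin n × Fin n) ℝ≥0} {ρ γ : Fin n → ℕ}
    (hty : ∀ m ∈ a.support, (∀ i, ∑ j, m (i, j) = ρ i) ∧ (∀ j, ∑ i, m (i, j) = γ j))
    {M : (Fin n × Fin n) →₀ ℕ} (hM : M ∈ (a * b).support) (π : Equiv.Perm (Fin n))
    (hrow : ∀ e ∈ M.support, e.1 ∈ A → (π e.2 = e.1 ∨ π e.2 = ζ e.1))
    (hcol : ∀ e ∈ M.support, e.2 ∈ B → e.2 ≠ bd → e.1 ∈ A) :
    (∀ i ∈ (Finset.univ.filter fun i => ρ i ≠ 0) ∩ A,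
        π.symm i ∈ (Finset.univ.filter fun j => γ j ≠ 0) ∨
          π.symm (ζ i) ∈ (Finset.univ.filter fun j => γ j ≠ 0)) ∧
      (∀ j ∈ (Finset.univ.filter fun j => γ j ≠ 0) ∩ B, j ≠ bd →
        π j ∈ (Finset.univ.filter fun i => ρ i ≠ 0) ∨
          ζ.symm (π j) ∈ (Finset.univ.filter fun i => ρ i ≠ 0)) := by
  classical
  obtain ⟨X, hX, Y, -, hXY⟩ := Finset.mem_add.mp (MvPolynomial.support_mul a b hM)
  have hle : ∀ e, X e ≤ M e := fun e => by
    rw [← hXY, Finsupp.add_apply]; exact Nat.le_add_right _ _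
  obtain ⟨hρ, hγ⟩ := hty X hX
  -- a cell of `X` is a cell of `M`
  have hmem : ∀ e, X e ≠ 0 → e ∈ M.support := fun e he =>
    Finsupp.mem_support_iff.mpr fun h0 => he (Nat.eq_zero_of_le_zero (h0 ▸ hle e))
  -- a nonzero cell `(i, j)` of `X` has `ρ i ≠ 0` and `γ j ≠ 0`
  have hρ_of : ∀ i j, X (i, j) ≠ 0 → ρ i ≠ 0 := by
    intro i j hij h0
    have h1 : X (i, j) ≤ ∑ j', X (i, j') :=
      Finset.single_le_sum (f := fun j' => X (i, j')) (fun _ _ => Nat.zero_le _) (Finset.mem_univ j)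
    rw [hρ i, h0] at h1
    exact hij (Nat.eq_zero_of_le_zero h1)
  have hγ_of : ∀ i j, X (i, j) ≠ 0 → γ j ≠ 0 := by
    intro i j hij h0
    have h1 : X (i, j) ≤ ∑ i', X (i', j) :=
      Finset.single_le_sum (f := fun i' => X (i', j)) (fun _ _ => Nat.zero_le _) (Finset.mem_univ i)
    rw [hγ j, h0] at h1
    exact hij (Nat.eq_zero_of_le_zero h1)
  refine ⟨?_, ?_⟩
  · -- (H): a hit row of `A` sees `T` through one of its two probe columns
    intro i hi
    obtain ⟨hiS, hiA⟩ := Finset.mem_inter.mp hi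
    have hsum : ∑ j, X (i, j) ≠ 0 := by rw [hρ i]; exact (Finset.mem_filter.mp hiS).2
    obtain ⟨j, -, hj⟩ := Finset.exists_ne_zero_of_sum_ne_zero hsum
    have hjT : j ∈ Finset.univ.filter (fun j => γ j ≠ 0) :=
      Finset.mem_filter.mpr ⟨Finset.mem_univ _, hγ_of i j hj⟩
    rcases hrow (i, j) (hmem (i, j) hj) hiA with h1 | h2
    · left
      have : π.symm i = j := by rw [← (show π j = i from h1)]; exact π.symm_apply_apply j
      rw [this]; exact hjT
    · right
      have : π.symm (ζ i) = j := by rw [← (show π j = ζ i from h2)]; exact π.symm_apply_apply j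
      rw [this]; exact hjT
  · -- (C): a hit column of `B ∖ {bd}` is a probe column of a hit row of `A`
    intro j hj hjbd
    obtain ⟨hjT, hjB⟩ := Finset.mem_inter.mp hj
    have hsum : ∑ i, X (i, j) ≠ 0 := by rw [hγ j]; exact (Finset.mem_filter.mp hjT).2
    obtain ⟨r, -, hr⟩ := Finset.exists_ne_zero_of_sum_ne_zero hsum
    have hrS : r ∈ Finset.univ.filter (fun i => ρ i ≠ 0) :=
      Finset.mem_filter.mpr ⟨Finset.mem_univ _, hρ_of r j hr⟩
    have hrA : r ∈ A := hcol (r, j) (hmem (r, j) hr) hjB hjbd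
    rcases hrow (r, j) (hmem (r, j) hr) hrA with h1 | h2
    · left; rw [show π j = r from h1]; exact hrS
    · right
      have : ζ.symm (π j) = r := by rw [show π j = ζ r from h2]; exact ζ.symm_apply_apply r
      rw [this]; exact hrS

/-- **The local row support as an intersection.**  `{i | ρ i ≠ 0} ∩ A = {i ∈ A | ρ i ≠ 0}`.
[folklore] -/
theorem filter_univ_inter_eq {n : ℕ} (A : Finset (Fin n)) (ρ : Fin n → ℕ) :
    (Finset.univ.filter fun i => ρ i ≠ 0) ∩ A = A.filter fun i => ρ i ≠ 0 := by
  ext i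
  simp only [Finset.mem_inter, Finset.mem_filter, Finset.mem_univ, true_and, and_comm]

/-- **stub_hybridSpreadRel — the local relative spread engine for hybrid probes.**  Window
`3 ≤ D ≤ #A`, `ζ` preserving `A`, dump column `bd`, `g` torus-homogeneous (margins `(R, C)`) with
the rows of `A` hit.  For every comparison set `P` of permutations `π` with `π(B) = A`, some typed
rectangle `(S, T)` with `#A < D · #(S ∩ A) ≤ 2 · #A` has
`#{π ∈ P : supp g has a hybrid probe for π} ≤ L(g) · #{π ∈ P : (H) ∀ i ∈ S ∩ A, π⁻¹ i ∈ T ∨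
π⁻¹ (ζ i) ∈ T, and (C) ∀ j ∈ T ∩ B, j ≠ bd → π j ∈ S ∨ ζ⁻¹ (π j) ∈ S}`.
Proof: `TypedDecompositionLocal.stub_typedDecompositionLocal` gives `g = Σ_{t<s} a_t b_t`,
`s ≤ L(g)`, every `a_t` typed with margins `(ρ_t, γ_t)` and `#A < D · #{i ∈ A | ρ_t i ≠ 0} ≤ 2 #A`;
a hybrid probe in `supp (a_t b_t)` for `π` makes `π` block-compatible with
`({ρ_t ≠ 0}, {γ_t ≠ 0})` (`rigid_of_hybridProbe`); so the probed part of `P` lies in the union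
over `t` of the block-compatible parts (`MvPolynomial.support_sum`), of total size `≤ s · max_t`
(`card_le_mul_max`), and `{ρ_t ≠ 0} ∩ A = {i ∈ A | ρ_t i ≠ 0}` (`filter_univ_inter_eq`) carries
the window.  If `s = 0` then `g = 0`, nothing is probed, and a local window set
(`exists_local_window`) with `T = ∅` will do.  (The hypotheses "`ζ` preserves `A`" and
"`π(B) = A` on `P`" are part of the registered signature but not needed.) [folklore] -/
theorem stub_hybridSpreadRel :
    ∀ (n D : ℕ) (A B : Finset (Fin n)) (ζ : Equiv.Perm (Fin n)) (bd : Fin n), 3 ≤ D → D ≤ A.card →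
      (∀ i, ζ i ∈ A ↔ i ∈ A) →
      ∀ (g : MvPolynomial (Fin n × Fin n) ℝ≥0) (R C : Fin n → ℕ),
        (∀ m ∈ g.support, (∀ i, ∑ j, m (i, j) = R i) ∧ (∀ j, ∑ i, m (i, j) = C j)) →
        (∀ i ∈ A, R i ≠ 0) →
        ∀ P : Finset (Equiv.Perm (Fin n)), (∀ π ∈ P, ∀ j, j ∈ B ↔ π j ∈ A) →
        ∃ S T : Finset (Fin n), A.card < D * (S ∩ A).card ∧ D * (S ∩ A).card ≤ 2 * A.card ∧
          (P.filter fun π => ∃ M ∈ g.support,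
              (∀ e ∈ M.support, e.1 ∈ A → (π e.2 = e.1 ∨ π e.2 = ζ e.1)) ∧
              (∀ e ∈ M.support, e.2 ∈ B → e.2 ≠ bd → e.1 ∈ A)).card ≤
            complexity g *
              (P.filter fun π => (∀ i ∈ S ∩ A, π.symm i ∈ T ∨ π.symm (ζ i) ∈ T) ∧
                (∀ j ∈ T ∩ B, j ≠ bd → π j ∈ S ∨ ζ.symm (π j) ∈ S)).card := by
  intro n D A B ζ bd hD hDA _ g R C hg hR P _
  obtain ⟨s, hs, a, b, hgab, htyp⟩ :=
    Summit.ValiantsHypothesis.ValiantsHypothesis.Theorems.DivisionGap.PerMultiplesHard.TypedDecompositionLocal.stub_typedDecompositionLocal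
      n D A hD hDA g R C hg hR
  rcases Nat.eq_zero_or_pos s with rfl | hs0
  · -- `g = Σ_{t ∈ Fin 0} a_t b_t = 0`: nothing is probed; any local window set will do
    obtain ⟨S, hSA, hlo, hhi⟩ := exists_local_window D A hD hDA
    have hSA' : S ∩ A = S := Finset.inter_eq_left.mpr hSA
    refine ⟨S, ∅, by rw [hSA']; exact hlo, by rw [hSA']; exact hhi, ?_⟩
    have hg0 : g = 0 := by rw [hgab]; exact Fin.sum_univ_zero _
    refine (Finset.card_eq_zero.mpr (Finset.filter_eq_empty_iff.mpr ?_)).trans_le (Nat.zero_le _)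
    rintro π - ⟨M, hM, -⟩
    rw [hg0, MvPolynomial.support_zero] at hM
    exact Finset.notMem_empty _ hM
  · -- `s > 0`: choose the types; a hybrid probe in `supp (a_t b_t)` forces block-compatibility
    choose ρ γ hty hlo hhi using htyp
    -- a maximising type `t₀` for the block-compatible parts of `P`
    obtain ⟨t₀, ht₀⟩ := card_le_mul_max hs0
      (fun t => P.filter fun π : Equiv.Perm (Fin n) =>
        (∀ i ∈ (Finset.univ.filter fun i => ρ t i ≠ 0) ∩ A,
            π.symm i ∈ (Finset.univ.filter fun j => γ t j ≠ 0) ∨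
              π.symm (ζ i) ∈ (Finset.univ.filter fun j => γ t j ≠ 0)) ∧
          (∀ j ∈ (Finset.univ.filter fun j => γ t j ≠ 0) ∩ B, j ≠ bd →
            π j ∈ (Finset.univ.filter fun i => ρ t i ≠ 0) ∨
              ζ.symm (π j) ∈ (Finset.univ.filter fun i => ρ t i ≠ 0)))
    have hlo' : A.card < D * ((Finset.univ.filter fun i => ρ t₀ i ≠ 0) ∩ A).card := by
      rw [filter_univ_inter_eq A (ρ t₀)]; exact hlo t₀
    have hhi' : D * ((Finset.univ.filter fun i => ρ t₀ i ≠ 0) ∩ A).card ≤ 2 * A.card := by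
      rw [filter_univ_inter_eq A (ρ t₀)]; exact hhi t₀
    refine ⟨Finset.univ.filter fun i => ρ t₀ i ≠ 0, Finset.univ.filter fun j => γ t₀ j ≠ 0,
      hlo', hhi', ?_⟩
    -- the probed part of `P` lies in the union of the block-compatible parts
    refine ((ht₀ _ fun π hπ => ?_).trans (Nat.mul_le_mul_right _ hs)).trans
      (Nat.mul_le_mul_left _ (Finset.card_le_card fun π hπ =>
        Finset.mem_filter.mpr (Finset.mem_filter.mp hπ)))
    obtain ⟨hπP, M, hMg, hrow, hcol⟩ := Finset.mem_filter.mp hπ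
    rw [hgab] at hMg
    obtain ⟨t, -, ht⟩ := Finset.mem_biUnion.mp (MvPolynomial.support_sum hMg)
    exact Finset.mem_biUnion.mpr ⟨t, Finset.mem_univ t,
      Finset.mem_filter.mpr ⟨hπP, rigid_of_hybridProbe (hty t) ht π hrow hcol⟩⟩

end Summit.ValiantsHypothesis.ValiantsHypothesis.Theorems.DivisionGap.PerMultiplesHard.HybridSpreadRel

end
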